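import Literature.MathematicalPhysics.QuantumFieldTheory.BalabanImbrieJaffe1984to88.BIJ88SlotFactorsSmooth308

/-!
# `BalabanImbrieJaffe1984to88.BIJ88SlotFactorsShell309` — T. Bałaban, J. Imbrie, A. Jaffe, *Effective action and cluster properties of
the abelian Higgs model*, Commun. Math. Phys. **114** (1988) 257–315 [BalabanImbrieJaffe1988]: p. 307 [PDF 51] (Sect. 5.13) and p. 309
[PDF 53] (Sect. 5.14) — **EVERY MIXED t/FIELD-DERIVATIVE OF A LOCATED χ-SLOT LIVES ON THE SHELL**.  Print, p. 307: *"Functional derivatives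
hitting χ-factors farther than ½r(e_k) from Λ₉^{(k)} produce factors e^{−cp(e_k)²} after integrating with respect to A^{(k)″}, φ^{(k)″}. These
derivatives are supported at |A^{(k)″}| ≥ cp(e_k) or |φ^{(k)″}| ≥ cp(e_k)"*; p. 309: *"the n-th derivative in t of χ(cp(e_k), A^{(k)}) is
bounded by t^{−n} times a function bounded by a constant and supported in c₁p(te_k) ≤ |A^{(k)}| ≤ c₂p(te_k)"*.  The located (5.14.4) by
print's route (integration by parts in every cube, SUCCESSOR-g21 §f) differentiates the t-differentiated χ-slots of p. 308 AGAIN in the field;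
this file proves the qualitative support statement for ALL mixed orders at once, from the structure file `BIJ88SlotFactorsSmooth308` (p36 g20)
and (5.2.3) (*"equal to zero for |x| ≥ 1, and equal to one for |x| ≤ 9/10"*): with `g_m(u) = ∂_s^m χ(1, u·ρ(s))|_{s=t}`,
`(d/du)^n g_m(u) = 0` whenever `|u·ρ(t)| < 9/10` and `(m,n) ≠ (0,0)`, or `|u·ρ(t)| > 1` (any `m, n`) — because near such `u` the factor
`s ↦ χ(1, u′·ρ(s))` is identically `1` resp. `0` near `t`.

statement-level skeleton of published theorems with citation tags; proofs where landed; nothing here is a claim about the Yang–Mills mass gap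

PDF held: `paper:balaban1988-cmp114-bij-abelian-higgs-effective-action` (journal page = PDF page + 256); pages re-read this session as text:
PDF 51 (p. 307) L9–12, PDF 53 (p. 309) L26–28.

CITATION HEADER (lean-in-tree rule).  Part of the lit-balaban TYPED SKELETON (HOME `run/shared/lean/pub/lit-balaban/`), Phase 2, seat p36
(gen 20, unit `lit-balaban-p36`); row **C2.Eq5.14.3-5.14.4** of `HOME/lit-balaban-r16/ROWS-C2-part2.md` (member: support input of the
§f route for the χ-slots in every cube; companion of `BIJ88SlotFactorsSmooth308`).  WHAT IS REPRODUCED (theorem-only; no definitions, no `Prop`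
facts; axioms standard): `iteratedDeriv_chi1_mul_eventuallyEq_const_of_lt` / `…_eventuallyEq_zero_of_gt` (local constancy of `g_m` below / above
the shell, joint continuity in `(u, s)`), **`iteratedDeriv_iteratedDeriv_chi1_mul_eq_zero_of_lt`** / **`…_of_gt`**, `abs_mem_shell_of_iteratedDeriv_ne_zero`
(a non-zero mixed derivative forces `9/10 ≤ |u·ρ(t)| ≤ 1`), and ON THE CELL'S OBJECTS **`iteratedFDeriv_cutoff_linear_eq_zero_of_lt`** /
**`…_of_gt`**: for a linear slot field `ℓ`, `t` on the branch, the `n`-th FIELD derivative `iteratedFDeriv ℝ n` of `φ ↦ ∂_t^m χ(c·p(te_k), ℓ(φ))`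
vanishes at every `φ` with `|ℓ(φ)/(c·p(te_k))| < 9/10` (`(m,n) ≠ (0,0)`) or `> 1`.
HONEST SCOPE.  Support statements only; the size of the derivatives on the shell (print's `t^{−n}`, the factorials of p. 307) and the Gaussian
shell factors `e^{−cp(te_k)²}` are NOT here (`BIJ88ChiTDerivN309`, `BIJ88ChiFieldDeriv307` for the one-variable versions).
-/

namespace Literature.MathematicalPhysics.QuantumFieldTheory.BalabanImbrieJaffe1984to88.BIJ88SlotFactorsShell309

open Finset Filter Topology
open scoped BigOperators ContDiff
open BIJ88SlotFactorsSmooth308 (iteratedDeriv_chi1_mul_eq_zero contDiffAt_inv_scale)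

/-! ## Shell support of every mixed `t`/field-derivative of a χ-slot (pp. 307, 309) -/

section Shell

variable (χ : BIJ88Sect5Statements.CutoffProfile) {ρ : ℝ → ℝ}

/-- BELOW THE SHELL the factor is flat: if `|u·ρ(t)| < 9/10` then, for `u′` near `u`, `s ↦ χ(1, u′·ρ(s))` is identically `1` near `t`
(`ρ` continuous at `t`), so `u′ ↦ ∂_s^m χ(1, u′·ρ(s))|_{s=t}` equals the constant `∂_s^m 1` near `u`.
[cite: BalabanImbrieJaffe1988, (5.2.3) p.278, (5.14.3) p.309] -/
theorem iteratedDeriv_chi1_mul_eventuallyEq_const_of_lt (m : ℕ) {t : ℝ} (hρ : ContinuousAt ρ t) {u : ℝ} (hu : |u * ρ t| < 9 / 10) :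
    (fun u' : ℝ => iteratedDeriv m (fun σ => χ.χ₁ (u' * ρ σ)) t) =ᶠ[𝓝 u] fun _ => if m = 0 then (1 : ℝ) else 0 := by
  have hc : ContinuousAt (fun q : ℝ × ℝ => |q.1 * ρ q.2|) (u, t) :=
    continuous_abs.continuousAt.comp (continuousAt_fst.mul (hρ.comp continuousAt_snd))
  have h2 : ∀ᶠ q : ℝ × ℝ in 𝓝 (u, t), |q.1 * ρ q.2| < 9 / 10 := hc.eventually_lt_const hu
  rw [nhds_prod_eq] at h2
  obtain ⟨U₁, hU₁, U₂, hU₂, hsub⟩ := Filter.mem_prod_iff.1 h2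
  filter_upwards [hU₁] with u' hu'
  have hev : (fun σ => χ.χ₁ (u' * ρ σ)) =ᶠ[𝓝 t] fun _ => (1 : ℝ) := by
    filter_upwards [hU₂] with σ hσ
    exact χ.eq_one _ (le_of_lt (hsub (Set.mk_mem_prod hu' hσ)))
  rw [hev.iteratedDeriv_eq, iteratedDeriv_const]

/-- ABOVE THE SHELL the factor vanishes: if `1 < |u·ρ(t)|` then `u′ ↦ ∂_s^m χ(1, u′·ρ(s))|_{s=t}` is identically `0` near `u`.
[cite: BalabanImbrieJaffe1988, (5.2.3) p.278, (5.14.3) p.309] -/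
theorem iteratedDeriv_chi1_mul_eventuallyEq_zero_of_gt (m : ℕ) {t : ℝ} (hρ : ContinuousAt ρ t) {u : ℝ} (hu : 1 < |u * ρ t|) :
    (fun u' : ℝ => iteratedDeriv m (fun σ => χ.χ₁ (u' * ρ σ)) t) =ᶠ[𝓝 u] fun _ => (0 : ℝ) := by
  have hc : ContinuousAt (fun u' : ℝ => |u' * ρ t|) u := continuous_abs.continuousAt.comp (continuousAt_id.mul continuousAt_const)
  filter_upwards [hc.eventually_const_lt hu] with u' hu'
  exact iteratedDeriv_chi1_mul_eq_zero χ m hρ hu'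

/-- **SHELL SUPPORT OF ALL MIXED DERIVATIVES** (p. 307: *"These derivatives are supported at |A^{(k)″}| ≥ cp(e_k) or |φ^{(k)″}| ≥ cp(e_k)"*;
p. 309: *"supported in c₁p(te_k) ≤ |A^{(k)}| ≤ c₂p(te_k)"*): below the shell every `u`-derivative of order `n` of `u ↦ ∂_s^m χ(1,u·ρ(s))|_{s=t}`
vanishes as soon as `(m, n) ≠ (0, 0)`. [cite: BalabanImbrieJaffe1988, §5.13 p.307, (5.14.3) p.309] -/
theorem iteratedDeriv_iteratedDeriv_chi1_mul_eq_zero_of_lt {m n : ℕ} (hmn : m ≠ 0 ∨ n ≠ 0) {t : ℝ} (hρ : ContinuousAt ρ t) {u : ℝ}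
    (hu : |u * ρ t| < 9 / 10) : iteratedDeriv n (fun u' : ℝ => iteratedDeriv m (fun σ => χ.χ₁ (u' * ρ σ)) t) u = 0 := by
  rw [(iteratedDeriv_chi1_mul_eventuallyEq_const_of_lt χ m hρ hu).iteratedDeriv_eq, iteratedDeriv_const]
  rcases hmn with hm | hn
  · simp [hm]
  · simp [hn]

/-- … and above the shell every such derivative vanishes, all orders. [cite: BalabanImbrieJaffe1988, §5.13 p.307, (5.14.3) p.309] -/
theorem iteratedDeriv_iteratedDeriv_chi1_mul_eq_zero_of_gt (m n : ℕ) {t : ℝ} (hρ : ContinuousAt ρ t) {u : ℝ} (hu : 1 < |u * ρ t|) :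
    iteratedDeriv n (fun u' : ℝ => iteratedDeriv m (fun σ => χ.χ₁ (u' * ρ σ)) t) u = 0 := by
  rw [(iteratedDeriv_chi1_mul_eventuallyEq_zero_of_gt χ m hρ hu).iteratedDeriv_eq, iteratedDeriv_const]
  simp

/-- contrapositive: a non-zero mixed derivative (`(m, n) ≠ (0, 0)`) forces the argument INTO THE SHELL `9/10 ≤ |u·ρ(t)| ≤ 1`.
[cite: BalabanImbrieJaffe1988, §5.13 p.307, (5.14.3) p.309] -/
theorem abs_mem_shell_of_iteratedDeriv_ne_zero {m n : ℕ} (hmn : m ≠ 0 ∨ n ≠ 0) {t : ℝ} (hρ : ContinuousAt ρ t) {u : ℝ}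
    (h : iteratedDeriv n (fun u' : ℝ => iteratedDeriv m (fun σ => χ.χ₁ (u' * ρ σ)) t) u ≠ 0) :
    9 / 10 ≤ |u * ρ t| ∧ |u * ρ t| ≤ 1 := by
  by_contra hne
  rcases not_and_or.1 hne with h1 | h1
  · exact h (iteratedDeriv_iteratedDeriv_chi1_mul_eq_zero_of_lt χ hmn hρ (not_le.1 h1))
  · exact h (iteratedDeriv_iteratedDeriv_chi1_mul_eq_zero_of_gt χ m n hρ (not_le.1 h1))

open BIJ88Sect2Statements (pLog)
open BIJ88Sect5Statements (cutoff)

variable {α : Type} [Fintype α]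

/-- **ON THE CELL'S OBJECTS — the FIELD-derivatives of a located χ-slot live on the shell**: for a linear slot field `ℓ`, `c ≠ 0`, `t` on the
branch and `(m, n) ≠ (0, 0)`, the `n`-th field derivative of `φ ↦ ∂_t^m χ(c·p(te_k), ℓ(φ))` VANISHES at every `φ` with
`|ℓ(φ)/(c·p(te_k))| < 9/10`, and (all orders) at every `φ` with `|ℓ(φ)/(c·p(te_k))| > 1` — print's support clauses for the derivatives the
integration by parts produces (p. 307) and for the t-derivatives (p. 309), jointly. [cite: BalabanImbrieJaffe1988, §5.13 p.307, (5.14.3) p.309] -/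
theorem iteratedFDeriv_cutoff_linear_eq_zero_of_lt (p : ℝ) {c ek t : ℝ} (hek : 0 < ek) (ht : 0 < t) (h1 : t * ek < 1)
    {ℓ : (α → ℝ) → ℝ} (hℓ : IsLinearMap ℝ ℓ) {m n : ℕ} (hmn : m ≠ 0 ∨ n ≠ 0) {φ : α → ℝ}
    (hφ : |ℓ φ / (c * pLog p (t * ek))| < 9 / 10) :
    iteratedFDeriv ℝ n (fun ψ : α → ℝ => iteratedDeriv m (fun s => cutoff χ (c * pLog p (s * ek)) (ℓ ψ)) t) φ = 0 := by
  have hρ : ContinuousAt (fun σ => (c * pLog p (σ * ek))⁻¹) t := (contDiffAt_inv_scale p c hek ⟨ht, h1⟩).continuousAt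
  rw [div_eq_mul_inv] at hφ
  have hL : Continuous ℓ := (IsLinearMap.mk' ℓ hℓ).continuous_of_finiteDimensional
  have hev := (iteratedDeriv_chi1_mul_eventuallyEq_const_of_lt χ m hρ hφ).comp_tendsto (hL.tendsto φ)
  have hev' : (fun ψ : α → ℝ => iteratedDeriv m (fun s => cutoff χ (c * pLog p (s * ek)) (ℓ ψ)) t) =ᶠ[𝓝 φ]
      fun _ => if m = 0 then (1 : ℝ) else 0 := by
    filter_upwards [hev] with ψ hψ
    simpa only [Function.comp, cutoff, div_eq_mul_inv] using hψ
  rw [(hev'.iteratedFDeriv ℝ n).self_of_nhds]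
  rcases hmn with hm | hn
  · simp only [hm, if_false]
    rcases Nat.eq_zero_or_pos n with hn0 | hnp
    · subst hn0; ext; simp
    · rw [iteratedFDeriv_const_of_ne (by omega)]; rfl
  · rw [iteratedFDeriv_const_of_ne hn]; rfl

/-- … and above the shell. [cite: BalabanImbrieJaffe1988, §5.13 p.307, (5.14.3) p.309] -/
theorem iteratedFDeriv_cutoff_linear_eq_zero_of_gt (p : ℝ) {c ek t : ℝ} (hek : 0 < ek) (ht : 0 < t) (h1 : t * ek < 1)
    {ℓ : (α → ℝ) → ℝ} (hℓ : IsLinearMap ℝ ℓ) (m n : ℕ) {φ : α → ℝ} (hφ : 1 < |ℓ φ / (c * pLog p (t * ek))|) :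
    iteratedFDeriv ℝ n (fun ψ : α → ℝ => iteratedDeriv m (fun s => cutoff χ (c * pLog p (s * ek)) (ℓ ψ)) t) φ = 0 := by
  have hρ : ContinuousAt (fun σ => (c * pLog p (σ * ek))⁻¹) t := (contDiffAt_inv_scale p c hek ⟨ht, h1⟩).continuousAt
  rw [div_eq_mul_inv] at hφ
  have hL : Continuous ℓ := (IsLinearMap.mk' ℓ hℓ).continuous_of_finiteDimensional
  have hev := (iteratedDeriv_chi1_mul_eventuallyEq_zero_of_gt χ m hρ hφ).comp_tendsto (hL.tendsto φ)
  have hev' : (fun ψ : α → ℝ => iteratedDeriv m (fun s => cutoff χ (c * pLog p (s * ek)) (ℓ ψ)) t) =ᶠ[𝓝 φ] fun _ => (0 : ℝ) := by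
    filter_upwards [hev] with ψ hψ
    simpa only [Function.comp, cutoff, div_eq_mul_inv] using hψ
  rw [(hev'.iteratedFDeriv ℝ n).self_of_nhds]
  rcases Nat.eq_zero_or_pos n with hn0 | hnp
  · subst hn0; ext; simp
  · rw [iteratedFDeriv_const_of_ne (by omega)]; rfl

end Shell

end Literature.MathematicalPhysics.QuantumFieldTheory.BalabanImbrieJaffe1984to88.BIJ88SlotFactorsShell309
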